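import Mathlib

/-!
# Solo-informed (session 13): kernel facts behind §5d of `axisymmetric-rigidity.md`
(the strip at `z₁ = π/2`: pole-aligned blow-up `W = (Y_c - Y₀)/c`, Lemma 8.16, Lemma 8.17).

* `stripBlowup_dd_u/v/s/p`: the four divided-difference identities that turn the swirling-cone system (S)
  into the W-system (pure ring identities: `N(Y₀ + cW) - (v₀ + cW_v)·u₀' = [N(Y₀) - v₀u₀'] + c·(linear) + c²·(quadratic)` etc.).
* `stripBlowup_bg`: the linear-cone identities `1 + 2u₀ = 3cos²`, `1 + 2u₀ + v₀ cot = (3/2)cos²`, `s₀ cot = σ cos`,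
  `-1 + u₀ + 2v₀ cot = -(3/2)(1 + cos²)` and the closed form of `p₀`, with `(C, S) = (cos φ, sin φ)`, `S ≠ 0`.
* `stripBlowup_hasDerivAt_u0/s0`: `u₀' = 2v₀`, `s₀' = σ cos`.
* `stripBlowup_chi`: `cot(z₁ + ψ) - cot(π/2 + ψ) = c/(cos ψ (cos ψ + c sin ψ))` in coordinates (`cot z₁ = c`).
* `stripBlowup_gamma`: `sin(arctan c) = cγ`, `cos(arctan c) = γ`, `γ - 1 = -c²γ²/(1 + γ)`, `γ = 1/√(1 + c²)`
  (the conversion cone-aligned → pole-aligned divides by nothing).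
* `stripBlowup_sq_log_le`: `t² log(1/t) ≤ 1/(2e)` on `(0, ∞)` (the constant in `𝒮̄` of Lemma 8.16).
No new definitions; axioms: standard.
-/

namespace Summit.NavierStokesRegularity.NavierStokesRegularity.Theorems

/-- (R)-component: `N(Y) = v² + s² - 2p - u - u²`; expansion of `N(Y₀ + cW) - (v₀ + cW_v)d` in powers of `c`. -/
theorem stripBlowup_dd_u (u0 v0 s0 p0 Wu Wv Ws Wp c d : ℝ) :
    (v0 + c * Wv) ^ 2 + (s0 + c * Ws) ^ 2 - 2 * (p0 + c * Wp) - (u0 + c * Wu) - (u0 + c * Wu) ^ 2 - (v0 + c * Wv) * d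
      = (v0 ^ 2 + s0 ^ 2 - 2 * p0 - u0 - u0 ^ 2 - v0 * d)
        + c * (2 * v0 * Wv + 2 * s0 * Ws - 2 * Wp - (1 + 2 * u0) * Wu - d * Wv)
        + c ^ 2 * (Wv ^ 2 + Ws ^ 2 - Wu ^ 2) := by
  ring

/-- (D)-component: `v' = -3u - v cot` is linear, so the divided difference is exact. -/
theorem stripBlowup_dd_v (u0 v0 Wu Wv c k : ℝ) :
    (-3 * (u0 + c * Wu) - (v0 + c * Wv) * k) - (-3 * u0 - v0 * k) = c * (-3 * Wu - k * Wv) := by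
  ring

/-- (A)-component: `A(Y) = -s(1 + 2u + v cot)`; expansion of `A(Y₀ + cW) - (v₀ + cW_v)e` in powers of `c`. -/
theorem stripBlowup_dd_s (u0 v0 s0 Wu Wv Ws c k e : ℝ) :
    -(s0 + c * Ws) * (1 + 2 * (u0 + c * Wu) + (v0 + c * Wv) * k) - (v0 + c * Wv) * e
      = (-(s0 * (1 + 2 * u0 + v0 * k)) - v0 * e)
        + c * (-(Ws * (1 + 2 * u0 + v0 * k)) - s0 * (2 * Wu + k * Wv) - e * Wv)
        + c ^ 2 * (-(Ws * (2 * Wu + k * Wv))) := by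
  ring

/-- (P)-component: `P(Y) = -v + uv + (v² + s²) cot`; `P(Y₀ + cW) - P(Y₀)` in powers of `c`. -/
theorem stripBlowup_dd_p (u0 v0 s0 Wu Wv Ws c k : ℝ) :
    (-(v0 + c * Wv) + (u0 + c * Wu) * (v0 + c * Wv) + ((v0 + c * Wv) ^ 2 + (s0 + c * Ws) ^ 2) * k)
      - (-v0 + u0 * v0 + (v0 ^ 2 + s0 ^ 2) * k)
      = c * (-Wv + u0 * Wv + v0 * Wu + (2 * v0 * Wv + 2 * s0 * Ws) * k)
        + c ^ 2 * (Wu * Wv + (Wv ^ 2 + Ws ^ 2) * k) := by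
  ring

/-- The linear-cone identities used to simplify the W-system (`C = cos φ`, `S = sin φ ≠ 0`, `cot = C/S`),
and the closed form `p₀ = σ²/4 - 7/16 - (σ²/4 + 9/16)(C² - S²)`. -/
theorem stripBlowup_bg (σ C S : ℝ) (hS : S ≠ 0) (h1 : S ^ 2 + C ^ 2 = 1) :
    (1 + 2 * ((3 * C ^ 2 - 1) / 2) = 3 * C ^ 2)
    ∧ (1 + 2 * ((3 * C ^ 2 - 1) / 2) + (-(3 / 2) * S * C) * (C / S) = 3 / 2 * C ^ 2)
    ∧ ((σ * S) * (C / S) = σ * C)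
    ∧ (-1 + (3 * C ^ 2 - 1) / 2 + 2 * (-(3 / 2) * S * C) * (C / S) = -(3 / 2) * (1 + C ^ 2))
    ∧ ((-(-(3 / 2) * S * C) ^ 2 + (σ * S) ^ 2 - (3 * C ^ 2 - 1) / 2 - ((3 * C ^ 2 - 1) / 2) ^ 2) / 2
        = σ ^ 2 / 4 - 7 / 16 - (σ ^ 2 / 4 + 9 / 16) * (C ^ 2 - S ^ 2)) := by
  refine ⟨by ring, ?_, ?_, ?_, ?_⟩
  · field_simp
    ring
  · field_simp
  · field_simp
    ring
  · linear_combination (σ ^ 2 / 4 - 9 / 8 * C ^ 2 - 9 / 16) * h1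

/-- `u₀ = (3cos² - 1)/2` has derivative `2v₀ = 2·(-(3/2) sin cos)`. -/
theorem stripBlowup_hasDerivAt_u0 (φ : ℝ) :
    HasDerivAt (fun x => (3 * Real.cos x ^ 2 - 1) / 2) (2 * (-(3 / 2) * Real.sin φ * Real.cos φ)) φ := by
  have h := (((Real.hasDerivAt_cos φ).pow 2).const_mul 3).sub_const 1 |>.div_const 2
  refine h.congr_deriv ?_
  ring

/-- `s₀ = σ sin` has derivative `σ cos`. -/
theorem stripBlowup_hasDerivAt_s0 (σ φ : ℝ) :
    HasDerivAt (fun x => σ * Real.sin x) (σ * Real.cos φ) φ :=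
  (Real.hasDerivAt_sin φ).const_mul σ

/-- `χ`: with `cot z₁ = c`, `cot(z₁ + ψ) = (c cos ψ - sin ψ)/(cos ψ + c sin ψ)` and `cot(π/2 + ψ) = -sin ψ/cos ψ`;
their difference is `c/(cos ψ (cos ψ + c sin ψ))` (`Cψ = cos ψ`, `Sψ = sin ψ`). -/
theorem stripBlowup_chi (c Cψ Sψ : ℝ) (hC : Cψ ≠ 0) (hD : Cψ + c * Sψ ≠ 0) (h1 : Sψ ^ 2 + Cψ ^ 2 = 1) :
    (c * Cψ - Sψ) / (Cψ + c * Sψ) - (-Sψ / Cψ) = c / (Cψ * (Cψ + c * Sψ)) := by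
  field_simp
  linear_combination c * h1

/-- `γ = 1/√(1 + c²)`: `sin(arctan c) = cγ`, `cos(arctan c) = γ`, and `γ - 1 = -c²γ²/(1 + γ)`. -/
theorem stripBlowup_gamma (c : ℝ) :
    Real.sin (Real.arctan c) = c * (1 / Real.sqrt (1 + c ^ 2))
    ∧ Real.cos (Real.arctan c) = 1 / Real.sqrt (1 + c ^ 2)
    ∧ (1 / Real.sqrt (1 + c ^ 2) - 1 = -(c ^ 2 * (1 / Real.sqrt (1 + c ^ 2)) ^ 2) / (1 + 1 / Real.sqrt (1 + c ^ 2))) := by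
  have hpos : 0 < 1 + c ^ 2 := by positivity
  have hsq : 0 < Real.sqrt (1 + c ^ 2) := Real.sqrt_pos.mpr hpos
  have hss : Real.sqrt (1 + c ^ 2) ^ 2 = 1 + c ^ 2 := Real.sq_sqrt hpos.le
  refine ⟨?_, ?_, ?_⟩
  · rw [Real.sin_arctan]; ring
  · rw [Real.cos_arctan]
  · have hne : Real.sqrt (1 + c ^ 2) ≠ 0 := hsq.ne'
    have hne2 : 1 + 1 / Real.sqrt (1 + c ^ 2) ≠ 0 := by positivity
    field_simp
    nlinarith [hss]

/-- `t² log(1/t) ≤ 1/(2e)` for every `t > 0` (maximum at `t = e^{-1/2}`); from `log x ≤ x - 1`. -/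
theorem stripBlowup_sq_log_le {t : ℝ} (h0 : 0 < t) :
    t ^ 2 * Real.log (1 / t) ≤ 1 / (2 * Real.exp 1) := by
  have he : 0 < Real.exp 1 := Real.exp_pos 1
  have ht2 : 0 < t ^ 2 := by positivity
  set x := 1 / (t ^ 2 * Real.exp 1) with hx
  have hxpos : 0 < x := by positivity
  have hlog := Real.log_le_sub_one_of_pos hxpos
  have hlx : Real.log x = 2 * Real.log (1 / t) - 1 := by
    rw [hx, Real.log_div one_ne_zero (by positivity), Real.log_one, Real.log_mul ht2.ne' he.ne',
      Real.log_exp, Real.log_pow, Real.log_div one_ne_zero h0.ne', Real.log_one]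
    push_cast
    ring
  rw [hlx] at hlog
  -- 2 log(1/t) ≤ x = 1/(t² e); multiply by t²/2
  have h3 : Real.log (1 / t) ≤ x / 2 := by linarith
  calc t ^ 2 * Real.log (1 / t) ≤ t ^ 2 * (x / 2) := by
        exact mul_le_mul_of_nonneg_left h3 ht2.le
    _ = 1 / (2 * Real.exp 1) := by rw [hx]; field_simp

end Summit.NavierStokesRegularity.NavierStokesRegularity.Theorems
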